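import Mathlib.MeasureTheory.Integral.MeanInequalities
import Literature.Analysis.FluidPDE.MixedNormSmooth
import Literature.Analysis.FluidPDE.EulerReynolds
import HarnessLib

/-!
# Countable Minkowski inequalities and mixed norms of series of smooth fields on the torus

Analysis/FluidPDE support file (all proved, [folklore]). It supplies the measure-theoretic
bookkeeping behind limits `u = u₀ + ∑ₖ wₖ` of telescoping series of jointly smooth space–time
fields on `[0, T] × 𝕋^d` measured in the accepted mixed norms `Torus.eLqLpNorm q p · (Ioo 0 T)`
(`Literature.Analysis.FluidPDE.LerayHopf`, Serrin 1963 §3) — the situation of every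
convex-integration scheme, and in particular of the proof of Thm. 1.7 of Cheskidov–Luo 2022
(§2.6: "Since `uₙ` is Cauchy in `L²_{t,x} ∩ L^p_t L^∞` … there exists `u` …"), whose assembly
from the main iteration (`Torus.CheskidovLuo2022MainIteration`) is the first consumer
(`Literature.Analysis.FluidPDE.NavierStokesReynoldsLimit`):

* `lintegral_rpow_sum_le`, `lintegral_rpow_tsum_le`: **Minkowski's inequality for countable
  sums** of `ℝ≥0∞`-valued functions in the `lintegral` form
  `(∫⁻ (∑' j, f j)^p)^{1/p} ≤ ∑' j, (∫⁻ (f j)^p)^{1/p}`, `p ≥ 1` (finite sums by Mathlib's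
  `ENNReal.lintegral_Lp_add_le`, then monotone convergence);
* slice norms `t ↦ ‖w(t)‖_{L^p(𝕋^d)}` of jointly smooth fields are a.e. measurable on `(0, T)`
  as `ℝ≥0∞`-valued maps (`IsSmoothSpaceTimeOn.aemeasurable_eLpNorm_slice`), the mixed norm with a
  finite real time exponent is the corresponding `lintegral`
  (`Torus.eLqLpNorm_eq_lintegral_rpow_of_smooth`), and in general it is bounded by the `lintegral`
  of any pointwise bound of the slice norms (`Torus.eLqLpNorm_le_lintegral_rpow`, no measurability
  or finiteness needed);
* `‖w‖_{L¹(0,T;L¹)} = ∫₀ᵀ ∫ ‖w‖` for smooth `w` (`Torus.toReal_eLqLpNorm_one_one_of_smooth`) and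
  the resulting bound of the **Reynolds defect by the `L¹_{t,x}` norm of the stress**,
  `|∫₀ᵀ∫ ∑ⱼ ⟪R^{(j)}, ∂ⱼψ⟫| ≤ card d · sup ‖∇ψ‖ · ‖R‖_{L¹(0,T;L¹)}`
  (`Torus.norm_integral_reynoldsDefect_le_eLqLpNorm`; the twin of
  `Torus.norm_integral_reynoldsDefect_le`, which uses the sup norm of `R`);
* `lintegral_enorm_sq_eq_sq_eLpNorm_two`: `∫⁻ ‖f‖ₑ² = ‖f‖_{L²}²`.

## References

* J. Serrin, *The initial value problem for the Navier–Stokes equations* (1963), §3 (mixed norms).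
* A. Cheskidov, X. Luo, *Sharp nonuniqueness for the Navier–Stokes equations*, Invent. Math. 229
  (2022) 987–1054 = arXiv:2009.06596, §2.6 (first consumer).
-/

open MeasureTheory Set Filter
open scoped ENNReal NNReal InnerProductSpace _root_.Topology

noncomputable section

namespace Literature.Analysis.FluidPDE

/-! ## Minkowski's inequality for finite and countable sums, `lintegral` form -/

section Minkowski

variable {α : Type*} [MeasurableSpace α] {μ : Measure α}

/-- **Minkowski's inequality for finite sums**, `lintegral` form: for `p ≥ 1` and a.e.-measurable
`f j : α → ℝ≥0∞`, `(∫⁻ (∑_{j<N} f j)^p)^{1/p} ≤ ∑_{j<N} (∫⁻ (f j)^p)^{1/p}` (induction on `N` from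
Mathlib's two-term `ENNReal.lintegral_Lp_add_le`). [folklore] -/
theorem lintegral_rpow_sum_le {p : ℝ} (hp : 1 ≤ p) (f : ℕ → α → ℝ≥0∞)
    (hf : ∀ j, AEMeasurable (f j) μ) (N : ℕ) :
    (∫⁻ a, (∑ j ∈ Finset.range N, f j a) ^ p ∂μ) ^ (1 / p) ≤
      ∑ j ∈ Finset.range N, (∫⁻ a, f j a ^ p ∂μ) ^ (1 / p) := by
  have hp0 : 0 < p := lt_of_lt_of_le zero_lt_one hp
  induction N with
  | zero =>
    simp only [Finset.range_zero, Finset.sum_empty]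
    rw [ENNReal.zero_rpow_of_pos hp0, lintegral_zero, ENNReal.zero_rpow_of_pos (by positivity)]
  | succ N ih =>
    have hmeas : AEMeasurable (fun a => ∑ j ∈ Finset.range N, f j a) μ :=
      Finset.aemeasurable_fun_sum _ fun j _ => hf j
    simp_rw [Finset.sum_range_succ]
    calc (∫⁻ a, (∑ j ∈ Finset.range N, f j a + f N a) ^ p ∂μ) ^ (1 / p)
        ≤ (∫⁻ a, (∑ j ∈ Finset.range N, f j a) ^ p ∂μ) ^ (1 / p) +
            (∫⁻ a, f N a ^ p ∂μ) ^ (1 / p) :=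
          ENNReal.lintegral_Lp_add_le hmeas (hf N) hp
      _ ≤ _ := add_le_add ih le_rfl

/-- **Minkowski's inequality for countable sums**, `lintegral` form: for `p ≥ 1` and
a.e.-measurable `f j : α → ℝ≥0∞`, `(∫⁻ (∑' j, f j)^p)^{1/p} ≤ ∑' j, (∫⁻ (f j)^p)^{1/p}` (the
finite case and monotone convergence along the partial sums). [folklore] -/
theorem lintegral_rpow_tsum_le {p : ℝ} (hp : 1 ≤ p) (f : ℕ → α → ℝ≥0∞)
    (hf : ∀ j, AEMeasurable (f j) μ) :
    (∫⁻ a, (∑' j, f j a) ^ p ∂μ) ^ (1 / p) ≤ ∑' j, (∫⁻ a, f j a ^ p ∂μ) ^ (1 / p) := by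
  have hp0 : 0 < p := lt_of_lt_of_le zero_lt_one hp
  have hp0' : 0 < 1 / p := by positivity
  set S : ℕ → α → ℝ≥0∞ := fun N a => ∑ j ∈ Finset.range N, f j a with hS_def
  have hS : ∀ N, AEMeasurable (S N) μ := fun N => Finset.aemeasurable_fun_sum _ fun j _ => hf j
  have hmono : ∀ a, Monotone fun N => S N a := fun a N N' h =>
    Finset.sum_le_sum_of_subset (Finset.range_mono h)
  have h1 : ∀ a, (∑' j, f j a) ^ p = ⨆ N, S N a ^ p := by
    intro a
    rw [ENNReal.tsum_eq_iSup_nat]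
    have h := (ENNReal.orderIsoRpow p hp0).map_iSup fun N => S N a
    simpa only [ENNReal.orderIsoRpow_apply] using h
  have h2 : ∫⁻ a, (∑' j, f j a) ^ p ∂μ = ⨆ N, ∫⁻ a, S N a ^ p ∂μ := by
    rw [lintegral_congr fun a => h1 a]
    exact lintegral_iSup' (fun N => (hS N).pow_const p)
      (ae_of_all _ fun a N N' h => ENNReal.rpow_le_rpow (hmono a h) hp0.le)
  have h3 : (⨆ N, ∫⁻ a, S N a ^ p ∂μ) ^ (1 / p) = ⨆ N, (∫⁻ a, S N a ^ p ∂μ) ^ (1 / p) := by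
    have h := (ENNReal.orderIsoRpow (1 / p) hp0').map_iSup fun N => ∫⁻ a, S N a ^ p ∂μ
    simpa only [ENNReal.orderIsoRpow_apply] using h
  rw [h2, h3]
  exact iSup_le fun N => (lintegral_rpow_sum_le hp f hf N).trans (ENNReal.sum_le_tsum _)

/-- `∫⁻ ‖f‖ₑ² = ‖f‖²_{L²}` (the `L²` norm as a `lintegral`). [folklore] -/
theorem lintegral_enorm_sq_eq_sq_eLpNorm_two {F : Type*} [NormedAddCommGroup F] (f : α → F) :
    ∫⁻ x, ‖f x‖ₑ ^ 2 ∂μ = eLpNorm f 2 μ ^ 2 := by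
  have h := lintegral_rpow_enorm_eq_rpow_eLpNorm' (μ := μ) (f := f) (q := 2) two_pos
  rw [eLpNorm_eq_eLpNorm' two_ne_zero ENNReal.ofNat_ne_top, ENNReal.toReal_ofNat,
    ← ENNReal.rpow_two, ← h]
  refine lintegral_congr fun x => ?_
  rw [ENNReal.rpow_two]

end Minkowski

namespace Torus

variable {d : Type*} [Fintype d]

/-! ## Slice norms and mixed norms of jointly smooth fields as `lintegral`s -/

section Slices

variable {F : Type*} [NormedAddCommGroup F] [NormedSpace ℝ F]
variable {T : ℝ} {w : ℝ → UnitAddTorus d → F}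

/-- Slice norms `t ↦ ‖w(t)‖_{L^p(𝕋^d)} ∈ ℝ≥0∞`, `p ≥ 1`, of a jointly smooth field on
`[0, T] × 𝕋^d` are a.e. measurable on `(0, T)` (they are finite and continuous there). [folklore] -/
theorem _root_.Literature.Analysis.FunctionSpaces.Torus.IsSmoothSpaceTimeOn.aemeasurable_eLpNorm_slice
    (hw : FunctionSpaces.Torus.IsSmoothSpaceTimeOn (Icc 0 T) w) {p : ℝ≥0∞} (hp : 1 ≤ p) :
    AEMeasurable (fun t => eLpNorm (w t) p volume) (volume.restrict (Ioo 0 T)) := by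
  have h := (hw.aestronglyMeasurable_eLpNorm_toReal hp).aemeasurable.ennreal_ofReal
  refine h.congr ?_
  filter_upwards [ae_restrict_mem measurableSet_Ioo] with t ht
  exact ENNReal.ofReal_toReal (hw.eLpNorm_slice_lt_top (Ioo_subset_Icc_self ht) p).ne

omit [NormedSpace ℝ F] in
/-- **Mixed norms are bounded by the `lintegral` of any bound of the slice norms**: if
`‖u(t)‖_{L^p} ≤ B(t)` for `t ∈ S` then `‖u‖_{L^q(S;L^p)} ≤ (∫⁻_S B^q)^{1/q}` for every real
`q > 0` (no measurability or finiteness is needed: the inner `toReal` only decreases the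
integrand). [folklore] -/
theorem eLqLpNorm_le_lintegral_rpow {u : ℝ → UnitAddTorus d → F} {S : Set ℝ} (hS : MeasurableSet S)
    {q : ℝ} (hq : 0 < q) (p : ℝ≥0∞) {B : ℝ → ℝ≥0∞} (hB : ∀ t ∈ S, eLpNorm (u t) p volume ≤ B t) :
    eLqLpNorm (ENNReal.ofReal q) p u S ≤ (∫⁻ t in S, B t ^ q) ^ (1 / q) := by
  rw [eLqLpNorm, FluidPDE.eLqLpNorm,
    eLpNorm_eq_lintegral_rpow_enorm_toReal (by simpa using hq) ENNReal.ofReal_ne_top,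
    ENNReal.toReal_ofReal hq.le]
  refine ENNReal.rpow_le_rpow (setLIntegral_mono' hS fun t ht => ENNReal.rpow_le_rpow ?_ hq.le)
    (by positivity)
  rw [Real.enorm_eq_ofReal ENNReal.toReal_nonneg]
  exact ENNReal.ofReal_toReal_le.trans (hB t ht)

/-- For a jointly smooth field on `[0, T] × 𝕋^d` and a real time exponent `q > 0`, the mixed norm
is the `lintegral` of the slice norms: `‖w‖_{L^q(0,T;L^p)} = (∫⁻_{(0,T)} ‖w(t)‖_{L^p}^q)^{1/q}`
(the slice norms are finite, so the inner `toReal` is faithful). [folklore] -/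
theorem eLqLpNorm_eq_lintegral_rpow_of_smooth (hw : FunctionSpaces.Torus.IsSmoothSpaceTimeOn (Icc 0 T) w)
    {q : ℝ} (hq : 0 < q) (p : ℝ≥0∞) :
    eLqLpNorm (ENNReal.ofReal q) p w (Ioo 0 T) =
      (∫⁻ t in Ioo 0 T, eLpNorm (w t) p volume ^ q) ^ (1 / q) := by
  rw [eLqLpNorm, FluidPDE.eLqLpNorm,
    eLpNorm_eq_lintegral_rpow_enorm_toReal (by simpa using hq) ENNReal.ofReal_ne_top,
    ENNReal.toReal_ofReal hq.le]
  congr 1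
  refine setLIntegral_congr_fun measurableSet_Ioo fun t ht => ?_
  rw [Real.enorm_eq_ofReal ENNReal.toReal_nonneg,
    ENNReal.ofReal_toReal (hw.eLpNorm_slice_lt_top (Ioo_subset_Icc_self ht) p).ne]

/-- The `L¹(0,T; L¹(𝕋^d))` norm of a jointly smooth field is the double integral of its
pointwise norm, `‖w‖_{L¹(0,T;L¹)} = ∫₀ᵀ ∫ ‖w(t,x)‖ dx dt`. [folklore] -/
theorem toReal_eLqLpNorm_one_one_of_smooth [CompleteSpace F]
    (hw : FunctionSpaces.Torus.IsSmoothSpaceTimeOn (Icc 0 T) w) :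
    (eLqLpNorm 1 1 w (Ioo 0 T)).toReal = ∫ t in Ioo 0 T, ∫ x, ‖w t x‖ := by
  rw [eLqLpNorm, FluidPDE.eLqLpNorm, eLpNorm_one_eq_lintegral_enorm,
    ← integral_norm_eq_lintegral_enorm (hw.aestronglyMeasurable_eLpNorm_toReal le_rfl)]
  refine setIntegral_congr_fun measurableSet_Ioo fun t ht => ?_
  rw [Real.norm_of_nonneg ENNReal.toReal_nonneg, eLpNorm_one_eq_lintegral_enorm,
    ← integral_norm_eq_lintegral_enorm
      (hw.isSmooth_slice (Ioo_subset_Icc_self ht)).continuous.aestronglyMeasurable]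

omit [Fintype d] [NormedSpace ℝ F] in
/-- The pointwise norm of a field with continuous space–time lift has a continuous space–time
lift. [folklore] -/
theorem continuousOn_stLift_norm {S : Set ℝ} {u : ℝ → UnitAddTorus d → F}
    (hu : ContinuousOn (FunctionSpaces.Torus.stLift u) (S ×ˢ univ)) :
    ContinuousOn (FunctionSpaces.Torus.stLift fun t x => ‖u t x‖) (S ×ˢ univ) := by
  have h : FunctionSpaces.Torus.stLift (fun t x => ‖u t x‖) =
      fun z => ‖FunctionSpaces.Torus.stLift u z‖ := by
    funext z; rfl
  rw [h]
  exact hu.norm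

/-- Time integrability on `(0, T)` of the slice `L¹` norms `t ↦ ∫ ‖w(t,x)‖ dx` of a jointly smooth
field on `[0, T] × 𝕋^d` (they are continuous on `[0, T]`). [folklore] -/
theorem integrableOn_integral_norm_of_smooth
    (hw : FunctionSpaces.Torus.IsSmoothSpaceTimeOn (Icc 0 T) w) :
    IntegrableOn (fun t => ∫ x, ‖w t x‖) (Ioo 0 T) volume :=
  ((FunctionSpaces.Torus.continuousOn_integral_of_continuousOn_stLift
    (continuousOn_stLift_norm hw.continuousOn_stLift)).integrableOn_compact
      isCompact_Icc).mono_set Ioo_subset_Icc_self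

end Slices

/-! ## The Reynolds defect is controlled by the `L¹_{t,x}` norm of the stress -/

section Defect

variable [DecidableEq d] {T : ℝ} {R : ℝ → UnitAddTorus d → d → EuclideanSpace ℝ d}

/-- **The Reynolds defect is controlled by the `L¹(0,T; L¹)` norm of the stress**: if
`‖∂ⱼψ(t) x‖ ≤ K` for all `j` on `(0, T) × 𝕋^d` and the stress `R` (stored by columns) is jointly
smooth on `[0, T] × 𝕋^d`, then
`|∫₀ᵀ ∫ ∑ⱼ ⟪R^{(j)}, ∂ⱼψ⟫| ≤ card d · K · ‖R‖_{L¹(0,T;L¹)}` — so the defect of a sequence of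
Navier–Stokes–Reynolds solutions tends to `0` with `‖Rₙ‖_{L¹_{t,x}}` (Cheskidov–Luo 2022, §2.6:
"`Rₙ → 0` in `L¹_{t,x}` … it follows that all terms above converge to their natural limits").
[folklore] -/
theorem norm_integral_reynoldsDefect_le_eLqLpNorm
    (hR : FunctionSpaces.Torus.IsSmoothSpaceTimeOn (Icc 0 T) R) {K : ℝ}
    {ψ : ℝ → UnitAddTorus d → EuclideanSpace ℝ d}
    (hψb : ∀ t ∈ Ioo 0 T, ∀ x, ∀ j, ‖FunctionSpaces.Torus.partialDeriv j (ψ t) x‖ ≤ K) :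
    ‖∫ t in Ioo 0 T, ∫ x, ∑ j, ⟪R t x j, FunctionSpaces.Torus.partialDeriv j (ψ t) x⟫_ℝ‖ ≤
      Fintype.card d * K * (eLqLpNorm 1 1 R (Ioo 0 T)).toReal := by
  -- pointwise bound of the integrand
  have hpt : ∀ t ∈ Ioo 0 T, ∀ x,
      ‖∑ j, ⟪R t x j, FunctionSpaces.Torus.partialDeriv j (ψ t) x⟫_ℝ‖ ≤
        Fintype.card d * K * ‖R t x‖ := by
    intro t ht x
    calc ‖∑ j, ⟪R t x j, FunctionSpaces.Torus.partialDeriv j (ψ t) x⟫_ℝ‖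
        ≤ ∑ j, ‖⟪R t x j, FunctionSpaces.Torus.partialDeriv j (ψ t) x⟫_ℝ‖ := norm_sum_le _ _
      _ ≤ ∑ _j : d, ‖R t x‖ * K := Finset.sum_le_sum fun j _ => by
          calc ‖⟪R t x j, FunctionSpaces.Torus.partialDeriv j (ψ t) x⟫_ℝ‖
              ≤ ‖R t x j‖ * ‖FunctionSpaces.Torus.partialDeriv j (ψ t) x‖ := norm_inner_le_norm _ _
            _ ≤ ‖R t x‖ * K :=
                mul_le_mul (norm_le_pi_norm (R t x) j) (hψb t ht x j) (norm_nonneg _) (norm_nonneg _)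
      _ = Fintype.card d * K * ‖R t x‖ := by
          rw [Finset.sum_const, Finset.card_univ, nsmul_eq_mul]; ring
  -- slice-wise bound by the slice `L¹` norm
  have hslice : ∀ t ∈ Ioo 0 T,
      ‖∫ x, ∑ j, ⟪R t x j, FunctionSpaces.Torus.partialDeriv j (ψ t) x⟫_ℝ‖ ≤
        Fintype.card d * K * ∫ x, ‖R t x‖ := by
    intro t ht
    have htI : t ∈ Icc 0 T := Ioo_subset_Icc_self ht
    have hRt : Continuous (R t) := (hR.isSmooth_slice htI).continuous
    rw [← integral_const_mul]
    exact norm_integral_le_of_norm_le ((hRt.norm.integrable_unitAddTorus).const_mul _)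
      (ae_of_all _ fun x => hpt t ht x)
  -- integrate in time
  calc ‖∫ t in Ioo 0 T, ∫ x, ∑ j, ⟪R t x j, FunctionSpaces.Torus.partialDeriv j (ψ t) x⟫_ℝ‖
      ≤ ∫ t in Ioo 0 T, Fintype.card d * K * ∫ x, ‖R t x‖ :=
        norm_integral_le_of_norm_le ((integrableOn_integral_norm_of_smooth hR).const_mul _)
          ((ae_restrict_iff' measurableSet_Ioo).2 (ae_of_all _ fun t ht => hslice t ht))
    _ = Fintype.card d * K * (eLqLpNorm 1 1 R (Ioo 0 T)).toReal := by
        rw [integral_const_mul, toReal_eLqLpNorm_one_one_of_smooth hR]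

end Defect

end Torus

end Literature.Analysis.FluidPDE
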